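import Mathlib
import HarnessLib
import Literature.Analysis.FluidPDE.SuitableWeak
import Literature.Analysis.FluidPDE.NSViscosityRescaling
import Literature.Analysis.FluidPDE.SpaceTimeRescaling

/-!
# Route QuarterJolt — tools for the support `NoFlatCellVertex` (stmt-NavierStokesRegularity-26465)

`--supports stmt-NavierStokesRegularity-26465` (seat ns-qj-p1 g0). Route-independent bookkeeping (no `Theses` import)
for `Theorems/QuarterJoltNoFlatCellVertex.lean`:

* STEP 2 — THE CUBIC FUNCTIONAL AT A FLAT CELL UNDER A TYPE-I WINDOW. If `‖w(t,x)‖ ≤ C/√(T−t)` on `(T−r², T)` and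
  `∫_{B_r(x₀)}|w(t)|² ≤ ε r` there, then `|w|³ ≤ |w|²·C/√(T−t)` and `∫_{T−r²}^T (T−t)^{−1/2} dt = 2r` give
  `∫∫_{Q_r(T,x₀)}|w|³ ≤ 2Cε r²`, i.e. `C(r; T, x₀) = cknC ≤ 2Cε` (`lintegral_Ioo_rpow_neg_half`,
  `lintegral_cylinder_cube_le`, `cknC_le_of_typeI_of_flat`); hence `C(r) → 0` as `r → 0⁺` when the scaled cell energy
  vanishes (`tendsto_cknC_of_typeI_of_flat`).
* STEP 3 — THE ν-NORMALISATION `w(s,y) = ν⁻¹u(s/ν,y)` (`timeRescale ν⁻¹ ν⁻¹ u`): a singular vertex `(T,x₀)` of `u`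
  (essential unboundedness on every `Q_r(T,x₀)`, `r² < T`) is a singular vertex `(νT, x₀)` of `w`
  (`singular_timeRescale`, via `eLpNorm_top_smul_stPull_preimage` — the statement and proof of the private lemma of
  the tree's Barker–Prange 2020 no-support file); a flat cell stays flat (`flat_timeRescale`, radius dilated by
  `max(1, 1/√ν)`); a Type-I window stays a Type-I window (`typeI_timeRescale`, constant `C/√ν`).

HONEST FRAMING: measure-theoretic bookkeeping for a GIVEN field; nothing about NS regularity is asserted. [folklore]
-/

noncomputable section

-- the summit and its single sub-problem share the name (CONVENTIONS §1), as in every Theorems file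
set_option linter.dupNamespace false

namespace Summit.NavierStokesRegularity.NavierStokesRegularity.Theorems

open MeasureTheory Set Function Filter Topology Metric
open scoped NNReal ENNReal
open Literature.Analysis.FluidPDE

namespace NoFlatCellVertex

/-! ### Step 2: the cubic functional under a Type-I bound and a flat cell -/

/-- The time integral `∫_{(a,b)} (b−t)^{−1/2} dt = 2√(b−a)` as a lower Lebesgue integral. -/
theorem lintegral_Ioo_rpow_neg_half {a b : ℝ} (hab : a < b) :
    ∫⁻ t in Ioo a b, ENNReal.ofReal ((b - t) ^ (-(1 / 2 : ℝ))) =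
      ENNReal.ofReal (2 * Real.sqrt (b - a)) := by
  have h1 : IntervalIntegrable (fun x : ℝ => x ^ (-(1 / 2 : ℝ))) volume (b - b) (b - a) :=
    intervalIntegral.intervalIntegrable_rpow' (by norm_num)
  have h2 : IntervalIntegrable (fun t : ℝ => (b - t) ^ (-(1 / 2 : ℝ))) volume a b := by
    have h := (h1.comp_sub_left b).symm
    simp only [sub_sub_cancel, sub_self, sub_zero] at h
    exact h
  have hint : IntegrableOn (fun t : ℝ => (b - t) ^ (-(1 / 2 : ℝ))) (Ioo a b) :=
    (intervalIntegrable_iff_integrableOn_Ioo_of_le hab.le).1 h2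
  have hnn : 0 ≤ᵐ[volume.restrict (Ioo a b)] fun t : ℝ => (b - t) ^ (-(1 / 2 : ℝ)) :=
    (ae_restrict_iff' measurableSet_Ioo).2
      (ae_of_all _ fun t ht => Real.rpow_nonneg (sub_nonneg.2 ht.2.le) _)
  rw [← ofReal_integral_eq_lintegral_ofReal hint hnn]
  congr 1
  have hsub := intervalIntegral.integral_comp_sub_left (fun x : ℝ => x ^ (-(1 / 2 : ℝ))) b
    (a := a) (b := b)
  rw [← integral_Ioc_eq_integral_Ioo, ← intervalIntegral.integral_of_le hab.le, hsub, sub_self,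
    integral_rpow (Or.inl (by norm_num)), show (-(1 / 2 : ℝ)) + 1 = 1 / 2 by norm_num,
    Real.zero_rpow (by norm_num), sub_zero, ← Real.sqrt_eq_rpow]
  ring

/-- `∫∫_{Q_r(T,x₀)} |w|³ ≤ 2Cε r²` when `|w(t,x)| ≤ C/√(T−t)` and `∫_{B_r(x₀)}|w(t)|² ≤ ε r` on the time window
`(T − r², T)` (Tonelli in inequality form; `|w|³ ≤ |w|²·C/√(T−t)`; `∫ (T−t)^{−1/2} = 2r`). -/
theorem lintegral_cylinder_cube_le {T C ε r : ℝ}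
    {w : ℝ → EuclideanSpace ℝ (Fin 3) → EuclideanSpace ℝ (Fin 3)} {x₀ : EuclideanSpace ℝ (Fin 3)}
    (hr : 0 < r) (hC : 0 ≤ C) (hε : 0 ≤ ε)
    (hI : ∀ t ∈ Ioo (T - r ^ 2) T, ∀ x, ‖w t x‖ ≤ C / Real.sqrt (T - t))
    (hA : ∀ t ∈ Ioo (T - r ^ 2) T, ∫⁻ x in ball x₀ r, ‖w t x‖ₑ ^ 2 ≤ ENNReal.ofReal (ε * r)) :
    ∫⁻ q in parabolicCylinder r ((T, x₀) : ℝ × EuclideanSpace ℝ (Fin 3)), ‖w q.1 q.2‖ₑ ^ (3 : ℕ) ≤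
      ENNReal.ofReal (2 * C * ε * r ^ 2) := by
  have hQ : parabolicCylinder r ((T, x₀) : ℝ × EuclideanSpace ℝ (Fin 3)) = Ioo (T - r ^ 2) T ×ˢ ball x₀ r :=
    rfl
  -- the slice bound
  have hslice : ∀ t ∈ Ioo (T - r ^ 2) T, ∫⁻ x in ball x₀ r, ‖w t x‖ₑ ^ (3 : ℕ) ≤
      ENNReal.ofReal (ε * r * C) * ENNReal.ofReal ((T - t) ^ (-(1 / 2 : ℝ))) := by
    intro t ht
    have hTt : 0 < T - t := sub_pos.2 ht.2
    have hpt : ∀ x, ‖w t x‖ₑ ^ (3 : ℕ) ≤ ‖w t x‖ₑ ^ 2 * ENNReal.ofReal (C / Real.sqrt (T - t)) := by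
      intro x
      rw [pow_succ]
      gcongr
      rw [← ofReal_norm]
      exact ENNReal.ofReal_le_ofReal (hI t ht x)
    calc ∫⁻ x in ball x₀ r, ‖w t x‖ₑ ^ (3 : ℕ)
        ≤ ∫⁻ x in ball x₀ r, ‖w t x‖ₑ ^ 2 * ENNReal.ofReal (C / Real.sqrt (T - t)) :=
          lintegral_mono hpt
      _ = (∫⁻ x in ball x₀ r, ‖w t x‖ₑ ^ 2) * ENNReal.ofReal (C / Real.sqrt (T - t)) :=
          lintegral_mul_const' _ _ ENNReal.ofReal_ne_top
      _ ≤ ENNReal.ofReal (ε * r) * ENNReal.ofReal (C / Real.sqrt (T - t)) :=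
          mul_le_mul_left (hA t ht) _
      _ = ENNReal.ofReal (ε * r * C) * ENNReal.ofReal ((T - t) ^ (-(1 / 2 : ℝ))) := by
          rw [← ENNReal.ofReal_mul (by positivity), ← ENNReal.ofReal_mul (by positivity)]
          congr 1
          rw [div_eq_mul_inv, Real.sqrt_eq_rpow, Real.rpow_neg hTt.le]
          ring
  calc ∫⁻ q in parabolicCylinder r ((T, x₀) : ℝ × EuclideanSpace ℝ (Fin 3)), ‖w q.1 q.2‖ₑ ^ (3 : ℕ)
      = ∫⁻ q, ‖w q.1 q.2‖ₑ ^ (3 : ℕ)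
          ∂((volume.restrict (Ioo (T - r ^ 2) T)).prod (volume.restrict (ball x₀ r))) := by
        rw [hQ, Measure.prod_restrict, ← Measure.volume_eq_prod]
    _ ≤ ∫⁻ t in Ioo (T - r ^ 2) T, ∫⁻ x in ball x₀ r, ‖w t x‖ₑ ^ (3 : ℕ) := lintegral_prod_le _
    _ ≤ ∫⁻ t in Ioo (T - r ^ 2) T,
          ENNReal.ofReal (ε * r * C) * ENNReal.ofReal ((T - t) ^ (-(1 / 2 : ℝ))) :=
        setLIntegral_mono' measurableSet_Ioo fun t ht => hslice t ht
    _ = ENNReal.ofReal (ε * r * C) *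
          ∫⁻ t in Ioo (T - r ^ 2) T, ENNReal.ofReal ((T - t) ^ (-(1 / 2 : ℝ))) :=
        lintegral_const_mul' _ _ ENNReal.ofReal_ne_top
    _ = ENNReal.ofReal (ε * r * C) * ENNReal.ofReal (2 * Real.sqrt (T - (T - r ^ 2))) := by
        rw [lintegral_Ioo_rpow_neg_half (by nlinarith : T - r ^ 2 < T)]
    _ = ENNReal.ofReal (2 * C * ε * r ^ 2) := by
        rw [sub_sub_cancel, Real.sqrt_sq hr.le, ← ENNReal.ofReal_mul (by positivity)]
        congr 1
        ring

/-- `C(r; T, x₀) ≤ 2Cε` under the Type-I bound with constant `C` and the flat cell with constant `ε` on `(T−r², T)`. -/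
theorem cknC_le_of_typeI_of_flat {T C ε r : ℝ}
    {w : ℝ → EuclideanSpace ℝ (Fin 3) → EuclideanSpace ℝ (Fin 3)} {x₀ : EuclideanSpace ℝ (Fin 3)}
    (hr : 0 < r) (hC : 0 ≤ C) (hε : 0 ≤ ε)
    (hI : ∀ t ∈ Ioo (T - r ^ 2) T, ∀ x, ‖w t x‖ ≤ C / Real.sqrt (T - t))
    (hA : ∀ t ∈ Ioo (T - r ^ 2) T, ∫⁻ x in ball x₀ r, ‖w t x‖ₑ ^ 2 ≤ ENNReal.ofReal (ε * r)) :
    cknC r ((T, x₀) : ℝ × EuclideanSpace ℝ (Fin 3)) w ≤ ENNReal.ofReal (2 * C * ε) := by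
  have h := lintegral_cylinder_cube_le hr hC hε hI hA
  have hr0 : ENNReal.ofReal r ^ 2 ≠ 0 := pow_ne_zero _ (ENNReal.ofReal_pos.2 hr).ne'
  have hrt : ENNReal.ofReal r ^ 2 ≠ ⊤ := ENNReal.pow_ne_top ENNReal.ofReal_ne_top
  unfold cknC
  calc (ENNReal.ofReal r ^ 2)⁻¹ *
        ∫⁻ q in parabolicCylinder r ((T, x₀) : ℝ × EuclideanSpace ℝ (Fin 3)), ‖w q.1 q.2‖ₑ ^ (3 : ℕ)
      ≤ (ENNReal.ofReal r ^ 2)⁻¹ * ENNReal.ofReal (2 * C * ε * r ^ 2) := mul_le_mul_right h _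
    _ = ENNReal.ofReal (2 * C * ε) := by
        rw [ENNReal.ofReal_mul (by positivity), ENNReal.ofReal_pow hr.le,
          mul_comm (ENNReal.ofReal (2 * C * ε)), ← mul_assoc, ENNReal.inv_mul_cancel hr0 hrt, one_mul]

/-- **The cubic functional vanishes at a flat cell under a Type-I window**: if `‖w(t,x)‖ ≤ C/√(T−t)` for
`t ∈ (T₁, T)` and the scaled cell energy at `x₀` vanishes, then `C(r; T, x₀) → 0` as `r → 0⁺`. -/
theorem tendsto_cknC_of_typeI_of_flat {T T₁ C : ℝ}
    {w : ℝ → EuclideanSpace ℝ (Fin 3) → EuclideanSpace ℝ (Fin 3)} {x₀ : EuclideanSpace ℝ (Fin 3)}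
    (hT₁ : T₁ < T) (hC : 0 ≤ C)
    (hI : ∀ t ∈ Ioo T₁ T, ∀ x, ‖w t x‖ ≤ C / Real.sqrt (T - t))
    (hflat : ∀ ε : ℝ, 0 < ε → ∃ r₀ : ℝ, 0 < r₀ ∧ ∀ r : ℝ, 0 < r → r < r₀ →
      ∀ t ∈ Ioc (T - r ^ 2) T, ∫⁻ x in ball x₀ r, ‖w t x‖ₑ ^ 2 ≤ ENNReal.ofReal (ε * r)) :
    Tendsto (fun r => cknC r ((T, x₀) : ℝ × EuclideanSpace ℝ (Fin 3)) w) (𝓝[>] 0) (𝓝 0) := by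
  rw [ENNReal.tendsto_nhds_zero]
  intro η hη
  -- a real level below `η`
  obtain ⟨e, he, heη⟩ : ∃ e : ℝ, 0 < e ∧ ENNReal.ofReal e ≤ η := by
    rcases eq_or_ne η ⊤ with h | h
    · exact ⟨1, one_pos, h ▸ le_top⟩
    · exact ⟨η.toReal, ENNReal.toReal_pos hη.ne' h, (ENNReal.ofReal_toReal h).le⟩
  obtain ⟨ε, hε0, hCε⟩ : ∃ ε : ℝ, 0 < ε ∧ 2 * C * ε ≤ e := by
    refine ⟨e / (2 * C + 1), by positivity, ?_⟩
    rw [mul_div_assoc', div_le_iff₀ (by positivity)]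
    nlinarith
  obtain ⟨r₀, hr₀, hr₀A⟩ := hflat ε hε0
  have hr₁0 : 0 < min r₀ (Real.sqrt (T - T₁)) := lt_min hr₀ (Real.sqrt_pos.2 (sub_pos.2 hT₁))
  filter_upwards [Ioo_mem_nhdsGT hr₁0] with r hr
  have hrr₀ : r < r₀ := lt_of_lt_of_le hr.2 (min_le_left _ _)
  have hr2 : r ^ 2 < T - T₁ := by
    have h1 : r < Real.sqrt (T - T₁) := lt_of_lt_of_le hr.2 (min_le_right _ _)
    have h2 := pow_lt_pow_left₀ h1 hr.1.le two_ne_zero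
    rwa [Real.sq_sqrt (sub_pos.2 hT₁).le] at h2
  have hIr : ∀ t ∈ Ioo (T - r ^ 2) T, ∀ x, ‖w t x‖ ≤ C / Real.sqrt (T - t) :=
    fun t ht x => hI t ⟨by linarith [ht.1], ht.2⟩ x
  have hAr : ∀ t ∈ Ioo (T - r ^ 2) T, ∫⁻ x in ball x₀ r, ‖w t x‖ₑ ^ 2 ≤ ENNReal.ofReal (ε * r) :=
    fun t ht => hr₀A r hr.1 hrr₀ t ⟨ht.1, ht.2.le⟩
  exact (cknC_le_of_typeI_of_flat hr.1 hC hε0.le hIr hAr).trans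
    ((ENNReal.ofReal_le_ofReal hCε).trans heη)

/-! ### Step 3: the ν-normalisation `w(s, y) = ν⁻¹ u(s/ν, y)` -/

/-- `L^∞` norms under an amplitude-`a` space–time affine pull-back (`β, γ > 0`, any centre):
`‖a · u ∘ Φ‖_{L^∞(Φ⁻¹ S)} = a ‖u‖_{L^∞(S)}` (same statement and proof as the private lemma of the tree's
Barker–Prange no-support file). -/
theorem eLpNorm_top_smul_stPull_preimage {a β γ : ℝ} (ha : 0 ≤ a) (hβ : 0 < β)
    (hγ : 0 < γ) (t₀ : ℝ) (x₀ : EuclideanSpace ℝ (Fin 3)) (S : Set (ℝ × (EuclideanSpace ℝ (Fin 3))))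
    (u : ℝ → (EuclideanSpace ℝ (Fin 3)) → (EuclideanSpace ℝ (Fin 3))) :
    eLpNorm (uncurry (a • stPull β γ t₀ x₀ u)) ∞
        (volume.restrict (stAffine β γ t₀ x₀ ⁻¹' S)) =
      ENNReal.ofReal a * eLpNorm (uncurry u) ∞ (volume.restrict S) := by
  have hme := measurableEmbedding_stAffine (E := EuclideanSpace ℝ (Fin 3)) hβ.ne' hγ.ne' t₀ x₀
  rw [eLpNorm_exponent_top, eLpNorm_exponent_top, eLpNormEssSup_eq_essSup_enorm,
    eLpNormEssSup_eq_essSup_enorm]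
  have hF : (fun w : ℝ × (EuclideanSpace ℝ (Fin 3)) => ‖uncurry (a • stPull β γ t₀ x₀ u) w‖ₑ) =
      fun w => ENNReal.ofReal a *
        ((fun w' : ℝ × (EuclideanSpace ℝ (Fin 3)) => ‖uncurry u w'‖ₑ) ∘ stAffine β γ t₀ x₀) w := by
    funext w
    rcases w with ⟨s, y⟩
    simp only [uncurry_apply_pair, Pi.smul_apply, stPull_apply, enorm_smul, Real.enorm_eq_ofReal ha,
      Function.comp_apply, stAffine_apply]
  rw [hF, ENNReal.essSup_const_mul]
  congr 1
  have h2 := hme.essSup_map_measure (μ := volume.restrict (stAffine β γ t₀ x₀ ⁻¹' S))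
    (g := fun w' : ℝ × (EuclideanSpace ℝ (Fin 3)) => ‖uncurry u w'‖ₑ)
  rw [map_stAffine_volume_restrict_preimage hβ hγ, finrank_euclideanSpace_fin,
    essSup_ennreal_smul_measure (by simp; positivity)] at h2
  exact h2.symm

/-- **A singular vertex stays singular under the ν-normalisation**: if `u` is essentially unbounded on every
`Q_r(T, x₀)` with `r² < T`, then `w = ν⁻¹u(·/ν)` is essentially unbounded on every `Q_ρ(νT, x₀)` with `ρ² < νT`
(the box `(T − ρ²/ν, T) × B_ρ(x₀)` contains `Q_{r₁}(T, x₀)`, `r₁ = min(ρ, ρ/√ν)`). -/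
theorem singular_timeRescale {ν T : ℝ} (hν : 0 < ν)
    {u : ℝ → EuclideanSpace ℝ (Fin 3) → EuclideanSpace ℝ (Fin 3)} {x₀ : EuclideanSpace ℝ (Fin 3)}
    (hsing : ∀ r : ℝ, 0 < r → r ^ 2 < T →
      eLpNorm (uncurry u) ∞
        (volume.restrict (parabolicCylinder r ((T, x₀) : ℝ × EuclideanSpace ℝ (Fin 3)))) = ∞)
    {ρ : ℝ} (hρ : 0 < ρ) (hρT : ρ ^ 2 < ν * T) :
    eLpNorm (uncurry (timeRescale ν⁻¹ ν⁻¹ u)) ∞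
      (volume.restrict (parabolicCylinder ρ ((ν * T, x₀) : ℝ × EuclideanSpace ℝ (Fin 3)))) = ∞ := by
  have hvst : timeRescale ν⁻¹ ν⁻¹ u = ν⁻¹ • stPull ν⁻¹ 1 0 0 u := by
    funext τ x
    simp only [timeRescale_apply, smul_stPull_apply, zero_add, one_smul]
  have hpre : stAffine ν⁻¹ 1 0 (0 : EuclideanSpace ℝ (Fin 3)) ⁻¹' (Ioo (T - ρ ^ 2 / ν) T ×ˢ ball x₀ ρ) =
      parabolicCylinder ρ ((ν * T, x₀) : ℝ × (EuclideanSpace ℝ (Fin 3))) := by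
    rw [stAffine_preimage_cylinder (inv_pos.2 hν) one_pos, parabolicCylinder]
    have e1 : (T - ρ ^ 2 / ν - 0) / ν⁻¹ = ν * T - ρ ^ 2 := by
      field_simp
      ring
    have e2 : (T - 0) / ν⁻¹ = ν * T := by rw [sub_zero, div_inv_eq_mul, mul_comm]
    rw [e1, e2, inv_one, sub_zero, one_smul, div_one]
  rw [hvst, ← hpre, eLpNorm_top_smul_stPull_preimage (inv_pos.2 hν).le (inv_pos.2 hν) one_pos]
  have hsν : 0 < Real.sqrt ν := Real.sqrt_pos.2 hν
  have hr₁ : 0 < min ρ (ρ / Real.sqrt ν) := lt_min hρ (div_pos hρ hsν)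
  have h2 : (min ρ (ρ / Real.sqrt ν)) ^ 2 ≤ ρ ^ 2 / ν := by
    have h3 : min ρ (ρ / Real.sqrt ν) ≤ ρ / Real.sqrt ν := min_le_right _ _
    have h4 : (ρ / Real.sqrt ν) ^ 2 = ρ ^ 2 / ν := by rw [div_pow, Real.sq_sqrt hν.le]
    rw [← h4]
    exact pow_le_pow_left₀ hr₁.le h3 2
  have hr₁T : (min ρ (ρ / Real.sqrt ν)) ^ 2 < T := by
    have : ρ ^ 2 / ν < T := by rw [div_lt_iff₀ hν]; linarith
    linarith
  have hsub : parabolicCylinder (min ρ (ρ / Real.sqrt ν)) ((T, x₀) : ℝ × (EuclideanSpace ℝ (Fin 3))) ⊆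
      Ioo (T - ρ ^ 2 / ν) T ×ˢ ball x₀ ρ := by
    rintro ⟨t, x⟩ htx
    rw [mem_parabolicCylinder] at htx
    obtain ⟨⟨ht1, ht2⟩, hx⟩ := htx
    refine ⟨⟨by simp only at ht1; linarith, ht2⟩, ?_⟩
    rw [mem_ball]
    exact lt_of_lt_of_le hx (min_le_left _ _)
  have htop : eLpNorm (uncurry u) ⊤ (volume.restrict (Ioo (T - ρ ^ 2 / ν) T ×ˢ ball x₀ ρ)) = ⊤ :=
    top_le_iff.1 ((hsing _ hr₁ hr₁T).symm.le.trans
      (eLpNorm_mono_measure _ (Measure.restrict_mono hsub le_rfl)))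
  rw [htop, ENNReal.mul_top]
  simpa using hν

/-- **A flat cell stays flat under the ν-normalisation**: the vanishing of the scaled cell energy of `u` at `(T, x₀)`
gives the same for `w = ν⁻¹u(·/ν)` at `(νT, x₀)` (radius dilated by `max(1, 1/√ν)`, amplitude `ν⁻²`). -/
theorem flat_timeRescale {ν T : ℝ} (hν : 0 < ν)
    {u : ℝ → EuclideanSpace ℝ (Fin 3) → EuclideanSpace ℝ (Fin 3)} {x₀ : EuclideanSpace ℝ (Fin 3)}
    (hflat : ∀ ε : ℝ, 0 < ε → ∃ r₀ : ℝ, 0 < r₀ ∧ ∀ r : ℝ, 0 < r → r < r₀ →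
      ∀ t ∈ Ioc (T - r ^ 2) T, ∫⁻ x in ball x₀ r, ‖u t x‖ₑ ^ 2 ≤ ENNReal.ofReal (ε * r)) :
    ∀ ε : ℝ, 0 < ε → ∃ r₀ : ℝ, 0 < r₀ ∧ ∀ r : ℝ, 0 < r → r < r₀ →
      ∀ s ∈ Ioc (ν * T - r ^ 2) (ν * T),
        ∫⁻ x in ball x₀ r, ‖timeRescale ν⁻¹ ν⁻¹ u s x‖ₑ ^ 2 ≤ ENNReal.ofReal (ε * r) := by
  intro ε hε
  have hsν : 0 < Real.sqrt ν := Real.sqrt_pos.2 hν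
  -- the dilation factor of the radius
  obtain ⟨m, hm1, hmν⟩ : ∃ m : ℝ, 1 ≤ m ∧ ν⁻¹ ≤ m ^ 2 := by
    refine ⟨max 1 (Real.sqrt ν)⁻¹, le_max_left _ _, ?_⟩
    have h1 : (Real.sqrt ν)⁻¹ ≤ max 1 (Real.sqrt ν)⁻¹ := le_max_right _ _
    have h2 := pow_le_pow_left₀ (inv_nonneg.2 hsν.le) h1 2
    rwa [inv_pow, Real.sq_sqrt hν.le] at h2
  have hm0 : 0 < m := by linarith
  obtain ⟨r₀, hr₀, hA⟩ := hflat (ε * ν ^ 2 / m) (by positivity)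
  refine ⟨r₀ / m, div_pos hr₀ hm0, fun r hr hrr₀ s hs => ?_⟩
  have hR : 0 < m * r := mul_pos hm0 hr
  have hRr₀ : m * r < r₀ := by rwa [lt_div_iff₀ hm0, mul_comm] at hrr₀
  -- the time `t = s/ν ∈ (T - (m r)², T]`
  have ht : ν⁻¹ * s ∈ Ioc (T - (m * r) ^ 2) T := by
    constructor
    · have h1 : ν * T - r ^ 2 < s := hs.1
      have h2 : T - r ^ 2 / ν < ν⁻¹ * s := by
        rw [show T - r ^ 2 / ν = ν⁻¹ * (ν * T - r ^ 2) by field_simp]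
        exact mul_lt_mul_of_pos_left h1 (inv_pos.2 hν)
      have h3 : r ^ 2 / ν ≤ (m * r) ^ 2 := by
        rw [mul_pow, div_eq_mul_inv, mul_comm]
        exact mul_le_mul_of_nonneg_right hmν (sq_nonneg r)
      linarith
    · have h1 : s ≤ ν * T := hs.2
      calc ν⁻¹ * s ≤ ν⁻¹ * (ν * T) := mul_le_mul_of_nonneg_left h1 (inv_pos.2 hν).le
        _ = T := by rw [← mul_assoc, inv_mul_cancel₀ hν.ne', one_mul]
  have hball : ball x₀ r ⊆ ball x₀ (m * r) := ball_subset_ball (le_mul_of_one_le_left hr.le hm1)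
  calc ∫⁻ x in ball x₀ r, ‖timeRescale ν⁻¹ ν⁻¹ u s x‖ₑ ^ 2
      = ∫⁻ x in ball x₀ r, ENNReal.ofReal ν⁻¹ ^ 2 * ‖u (ν⁻¹ * s) x‖ₑ ^ 2 := by
        refine lintegral_congr fun x => ?_
        rw [timeRescale_apply, enorm_smul, mul_pow, Real.enorm_eq_ofReal (inv_pos.2 hν).le]
    _ = ENNReal.ofReal ν⁻¹ ^ 2 * ∫⁻ x in ball x₀ r, ‖u (ν⁻¹ * s) x‖ₑ ^ 2 :=
        lintegral_const_mul' _ _ (ENNReal.pow_ne_top ENNReal.ofReal_ne_top)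
    _ ≤ ENNReal.ofReal ν⁻¹ ^ 2 * ∫⁻ x in ball x₀ (m * r), ‖u (ν⁻¹ * s) x‖ₑ ^ 2 :=
        mul_le_mul_right (lintegral_mono_set hball) _
    _ ≤ ENNReal.ofReal ν⁻¹ ^ 2 * ENNReal.ofReal (ε * ν ^ 2 / m * (m * r)) :=
        mul_le_mul_right (hA (m * r) hR hRr₀ _ ht) _
    _ = ENNReal.ofReal (ε * r) := by
        rw [← ENNReal.ofReal_pow (inv_pos.2 hν).le, ← ENNReal.ofReal_mul (by positivity)]
        congr 1
        field_simp

/-- **The Type-I window under the ν-normalisation**: `‖u(t,x)‖ ≤ C/√(T−t)` on `(T₁,T)` gives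
`‖w(s,y)‖ ≤ (C/√ν)/√(νT−s)` on `(νT₁, νT)` for `w = ν⁻¹u(·/ν)`. -/
theorem typeI_timeRescale {ν T T₁ C : ℝ} (hν : 0 < ν)
    {u : ℝ → EuclideanSpace ℝ (Fin 3) → EuclideanSpace ℝ (Fin 3)}
    (hI : ∀ t ∈ Ioo T₁ T, ∀ x, ‖u t x‖ ≤ C / Real.sqrt (T - t)) :
    ∀ s ∈ Ioo (ν * T₁) (ν * T), ∀ x,
      ‖timeRescale ν⁻¹ ν⁻¹ u s x‖ ≤ (C / Real.sqrt ν) / Real.sqrt (ν * T - s) := by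
  intro s hs x
  have hsν : 0 < Real.sqrt ν := Real.sqrt_pos.2 hν
  have ht : ν⁻¹ * s ∈ Ioo T₁ T := by
    constructor
    · have := mul_lt_mul_of_pos_left hs.1 (inv_pos.2 hν)
      rwa [← mul_assoc, inv_mul_cancel₀ hν.ne', one_mul] at this
    · have := mul_lt_mul_of_pos_left hs.2 (inv_pos.2 hν)
      rwa [← mul_assoc, inv_mul_cancel₀ hν.ne', one_mul] at this
  have h := hI _ ht x
  have e : Real.sqrt (T - ν⁻¹ * s) = Real.sqrt (ν * T - s) / Real.sqrt ν := by
    rw [show T - ν⁻¹ * s = (ν * T - s) / ν by field_simp, Real.sqrt_div' _ hν.le]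
  rw [e, div_div_eq_mul_div] at h
  rw [timeRescale_apply, norm_smul, norm_inv, Real.norm_of_nonneg hν.le]
  have hνs : Real.sqrt ν * Real.sqrt ν = ν := Real.mul_self_sqrt hν.le
  have hinv : ν⁻¹ * Real.sqrt ν = (Real.sqrt ν)⁻¹ := by
    rw [inv_mul_eq_iff_eq_mul₀ hν.ne', eq_mul_inv_iff_mul_eq₀ hsν.ne']
    exact hνs
  calc ν⁻¹ * ‖u (ν⁻¹ * s) x‖ ≤ ν⁻¹ * (C * Real.sqrt ν / Real.sqrt (ν * T - s)) :=
        mul_le_mul_of_nonneg_left h (inv_pos.2 hν).le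
    _ = C * (ν⁻¹ * Real.sqrt ν) / Real.sqrt (ν * T - s) := by ring
    _ = C / Real.sqrt ν / Real.sqrt (ν * T - s) := by rw [hinv, div_eq_mul_inv C (Real.sqrt ν)]

end NoFlatCellVertex

end Summit.NavierStokesRegularity.NavierStokesRegularity.Theorems

end
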